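import Summits.NavierStokesRegularity.NavierStokesRegularity.Theorems.ExtremiserTransienceNearExtremalTransienceExtremiserLiouvilleConstantSpeedSlideEnstrophyLaw
import Summits.NavierStokesRegularity.NavierStokesRegularity.Theorems.ExtremiserTransienceNearExtremalTransienceExtremiserLiouvilleConstantSpeedSlideKinematics
import Summits.NavierStokesRegularity.NavierStokesRegularity.Theorems.ExtremiserTransienceNearExtremalTransienceExtremiserLiouvilleConstantSpeedEnergyFluxInvariance
import HarnessLib

/-!
# Crux `ExtremiserTransience.NearExtremalTransience` (stmt-NavierStokesRegularity-21883), line `extremiser_liouville`,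
# stub K1b — THE ENSTROPHY LAW OF THE PIOLA SLIDE FOR THE RESIDUE JET (W′-line of the coercive inequality)

`--supports stmt-NavierStokesRegularity-21883` (helper).  Author: prover seat `ns-el-k1b` (g8).  Record:
`Cruxes/NearExtremalTransience/Lines/extremiser_liouville_k1b_slide.md` §0, (INEQ).  Assembles `…SlideEnstrophyLaw` (identity (A)),
`…SlideKinematics` ((KIN)) and g5's energy-flux invariance `integral_deriv_axialTest_mul_sq_eq_zero` (p670434).

For the residue JET (`V = w − c`, `⟪V,c⟫ = −‖V‖²/2`, `c` axial, all slabs square integrable) the enstrophy variation along the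
slide generator `φ_g = g(x₂)∂₂V + g′(x₂)V_h` contains NO undifferentiated `V`:
```
  a₁(φ_g) = ∫g′[ (3/2)|∂₂V_h|² + ½ω₂² − ½|∇_hV₂|² − ⟪∇_hV₂,∂₂V_h⟫ ] + 2∫g′(∂₂V₂)² + 2∫g′⟪∇_hV₂,∂₂V_h⟫ .
```
Since `−W′a₁(φ_g)` is the `W′`-part of `ℓ(φ_g)` and KKT along the slide gives `ℓ(φ_g) ≥ 0` (record §1), this is the coercive
`W′`-line of (INEQ): `3|∂₂V_h|² + ω₂² + 4(∂₂V₂)²` with a definite sign against the `V₂`-small terms `|∇_hV₂|²`, `⟪∇_hV₂,∂₂V_h⟫`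
(`|∇_hV₂| ≤ (‖V‖/M)|∇_hV|` on the residue).  What remains for the jet kill: the `Z′`-line (palinstrophy variation), the cubic
`S`-terms, the KKT inequality along the slide, and the endgame (record §3–5, §8).

WHAT THIS IS NOT: K1b is NOT proved; nothing here proves NS regularity. [folklore]
-/

noncomputable section

open Set Filter Topology MeasureTheory Metric Function InnerProductSpace
open scoped ENNReal NNReal Topology InnerProductSpace RealInnerProductSpace ContDiff
open Literature.Analysis.FluidPDE Literature.Analysis

namespace Summit.NavierStokesRegularity.NavierStokesRegularity.Theorems

-- the problem directory repeats the summit name (`NavierStokesRegularity/NavierStokesRegularity`)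
set_option linter.dupNamespace false

namespace ExtremiserLiouville

open DepletionLadder.KStar

variable {V : EuclideanSpace ℝ (Fin 3) → EuclideanSpace ℝ (Fin 3)} {g w : ℝ → ℝ}

/-! ## Tools: integrability of slab-supported weighted densities -/

/-- Coordinates are bounded by the norm. [folklore] -/
theorem abs_coord_le_norm (y : EuclideanSpace ℝ (Fin 3)) (i : Fin 3) : |y i| ≤ ‖y‖ := by
  have := PiLp.norm_apply_le (p := 2) y i; rwa [Real.norm_eq_abs] at this

/-- Entries of the Jacobian are bounded by its operator norm. [folklore] -/
theorem abs_fderiv_coord_le_norm (V : EuclideanSpace ℝ (Fin 3) → EuclideanSpace ℝ (Fin 3)) (x : EuclideanSpace ℝ (Fin 3))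
    (i j : Fin 3) : |fderiv ℝ V x (EuclideanSpace.single j 1) i| ≤ ‖fderiv ℝ V x‖ := by
  refine (abs_coord_le_norm _ i).trans ?_
  calc ‖fderiv ℝ V x (EuclideanSpace.single j 1)‖ ≤ ‖fderiv ℝ V x‖ * ‖(EuclideanSpace.single j (1 : ℝ) : EuclideanSpace ℝ (Fin 3))‖ :=
        (fderiv ℝ V x).le_opNorm _
    _ = ‖fderiv ℝ V x‖ := by rw [PiLp.norm_single, norm_one, mul_one]

/-- **Slab-supported `w(x₂)·Vᵢ·(DV eⱼ)ᵢ′` is integrable** when `|w| ≤ K` vanishes for `T ≤ |s|`, `‖V‖²` is integrable on the slab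
`{|x₂| ≤ T}` and `DV ∈ L²` (`|w V DV| ≤ K(1_{slab}‖V‖² + ‖DV‖²)`). [folklore] -/
theorem integrable_axialWeight_mul_coord_mul_fderiv (hV : ContDiff ℝ 1 V) (hw : Continuous w) {K T : ℝ}
    (hwK : ∀ s, |w s| ≤ K) (hwT : ∀ s, T ≤ |s| → w s = 0)
    (hD : Integrable (fun x => ‖fderiv ℝ V x‖ ^ 2) volume)
    (hslab : Integrable (fun x => {x : EuclideanSpace ℝ (Fin 3) | |x 2| ≤ T}.indicator (fun x => ‖V x‖ ^ 2) x) volume)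
    (i i' j : Fin 3) :
    Integrable (fun x => w (x 2) * (V x i * fderiv ℝ V x (EuclideanSpace.single j 1) i')) volume := by
  have hK0 : 0 ≤ K := (abs_nonneg _).trans (hwK 0)
  set SL : Set (EuclideanSpace ℝ (Fin 3)) := {x | |x 2| ≤ T} with hSL
  have cV : Continuous V := hV.continuous
  have cDV : Continuous (fderiv ℝ V) := hV.continuous_fderiv one_ne_zero
  have iG : Integrable (fun x => K * (SL.indicator (fun x => ‖V x‖ ^ 2) x + ‖fderiv ℝ V x‖ ^ 2)) volume :=
    (hslab.add hD).const_mul K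
  refine iG.mono' ?_ (Eventually.of_forall fun x => ?_)
  · exact ((hw.comp (PiLp.continuous_apply 2 _ (2 : Fin 3))).mul (((PiLp.continuous_apply 2 _ i).comp cV).mul
      ((PiLp.continuous_apply 2 _ i').comp (cDV.clm_apply continuous_const)))).aestronglyMeasurable
  rw [Real.norm_eq_abs]
  dsimp only
  by_cases hx : w (x 2) = 0
  · rw [hx, zero_mul, abs_zero]; exact mul_nonneg hK0 (add_nonneg (indicator_nonneg (fun _ _ => sq_nonneg _) _) (sq_nonneg _))
  have hxT : |x 2| ≤ T := by by_contra hc; exact hx (hwT _ (not_le.1 hc).le)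
  rw [indicator_of_mem (show x ∈ SL from hxT), abs_mul, abs_mul]
  have h1 : |V x i| * |fderiv ℝ V x (EuclideanSpace.single j 1) i'| ≤ ‖V x‖ * ‖fderiv ℝ V x‖ :=
    mul_le_mul (abs_coord_le_norm _ i) (abs_fderiv_coord_le_norm V x i' j) (abs_nonneg _) (norm_nonneg _)
  have h2 : ‖V x‖ * ‖fderiv ℝ V x‖ ≤ ‖V x‖ ^ 2 + ‖fderiv ℝ V x‖ ^ 2 := by
    nlinarith [sq_nonneg (‖V x‖ - ‖fderiv ℝ V x‖), norm_nonneg (V x), norm_nonneg (fderiv ℝ V x)]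
  calc |w (x 2)| * (|V x i| * |fderiv ℝ V x (EuclideanSpace.single j 1) i'|) ≤ K * (‖V x‖ * ‖fderiv ℝ V x‖) :=
        mul_le_mul (hwK _) h1 (by positivity) hK0
    _ ≤ K * (‖V x‖ ^ 2 + ‖fderiv ℝ V x‖ ^ 2) := mul_le_mul_of_nonneg_left h2 hK0

/-- **Slab-supported `w(x₂)·V₂²` is integrable** (`V₂² ≤ ‖V‖²`). [folklore] -/
theorem integrable_axialWeight_mul_coord_sq (hV : ContDiff ℝ 1 V) (hw : Continuous w) {K T : ℝ}
    (hwK : ∀ s, |w s| ≤ K) (hwT : ∀ s, T ≤ |s| → w s = 0)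
    (hslab : Integrable (fun x => {x : EuclideanSpace ℝ (Fin 3) | |x 2| ≤ T}.indicator (fun x => ‖V x‖ ^ 2) x) volume) :
    Integrable (fun x => w (x 2) * (V x 2) ^ 2) volume := by
  have hK0 : 0 ≤ K := (abs_nonneg _).trans (hwK 0)
  set SL : Set (EuclideanSpace ℝ (Fin 3)) := {x | |x 2| ≤ T} with hSL
  refine (hslab.const_mul K).mono' ((hw.comp (PiLp.continuous_apply 2 _ (2 : Fin 3))).mul
    (((PiLp.continuous_apply 2 _ (2 : Fin 3)).comp hV.continuous).pow 2)).aestronglyMeasurable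
    (Eventually.of_forall fun x => ?_)
  rw [Real.norm_eq_abs, abs_mul, abs_of_nonneg (sq_nonneg (V x 2))]
  by_cases hx : w (x 2) = 0
  · rw [hx, abs_zero, zero_mul]; exact mul_nonneg hK0 (indicator_nonneg (fun _ _ => sq_nonneg _) _)
  have hxT : |x 2| ≤ T := by by_contra hc; exact hx (hwT _ (not_le.1 hc).le)
  rw [indicator_of_mem (show x ∈ SL from hxT)]
  have hv2 : (V x 2) ^ 2 ≤ ‖V x‖ ^ 2 := by
    rw [← sq_abs]; exact pow_le_pow_left₀ (abs_nonneg _) (abs_coord_le_norm _ 2) 2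
  exact mul_le_mul (hwK _) hv2 (sq_nonneg _) hK0

/-! ## The jet assembly -/

/-- **ENSTROPHY LAW OF THE PIOLA SLIDE FOR THE RESIDUE JET.**  Let `V = w − c ∈ C²` be divergence free with the constant-speed
relation `⟪V, c⟫ = −‖V‖²/2`, `c = (0,0,c₂) ≠ 0` (axial frame), `DV ∈ L²`, `ω, ∂₂ω, ∂₂(∂₂V) ∈ L²`, and all slabs `{|x₂| ≤ T}`
square integrable (the JET branch).  Then for every axial profile `g ∈ C³` with `|g|,…,|g‴| ≤ K` and `g′, g″, g‴` vanishing for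
`T ≤ |s|` (`T > 0`), the enstrophy variation along the slide generator `φ_g = g(x₂)∂₂V + g′(x₂)V_h` is the `g′`-WEIGHTED DERIVATIVE
FORM
`a₁(φ_g) = ∫g′[(3/2)|∂₂V_h|² + ½ω₂² − ½|∇_hV₂|² − ⟪∇_hV₂,∂₂V_h⟫] + 2∫g′(∂₂V₂)² + 2∫g′⟪∇_hV₂,∂₂V_h⟫`
— no undifferentiated `V` is left: the energy-flux invariance (`integral_deriv_axialTest_mul_sq_eq_zero`, p670434) kills
`∫g‴‖V‖²` and `…SlideKinematics` converts `∫g‴V₂²`.  With `−W′a₁` entering `ℓ(φ_g)` this is the coercive `W′`-line of (INEQ) in the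
record (vertical shear `3|∂₂V_h|²`, axial vorticity `ω₂²`, `4(∂₂V₂)²` against the `V₂`-small `|∇_hV₂|²`, `⟪∇_hV₂,∂₂V_h⟫`).
[folklore] -/
theorem slideEnstrophyLaw_jet {c : EuclideanSpace ℝ (Fin 3)} (hV : ContDiff ℝ 2 V) (hdiv : VectorCalculus.IsDivFree V)
    (hVc : ∀ x, ⟪V x, c⟫ = -(‖V x‖ ^ 2 / 2)) (hc0 : c 0 = 0) (hc1 : c 1 = 0) (hc2 : c 2 ≠ 0)
    (hg : ContDiff ℝ 3 g) {K T : ℝ} (hT : 0 < T)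
    (hgK : ∀ s, |g s| ≤ K) (hg1K : ∀ s, |deriv g s| ≤ K) (hg2K : ∀ s, |deriv (deriv g) s| ≤ K)
    (hg3K : ∀ s, |deriv (deriv (deriv g)) s| ≤ K)
    (hg1T : ∀ s, T ≤ |s| → deriv g s = 0) (hg2T : ∀ s, T ≤ |s| → deriv (deriv g) s = 0)
    (hg3T : ∀ s, T ≤ |s| → deriv (deriv (deriv g)) s = 0)
    (hD : Integrable (fun x => ‖fderiv ℝ V x‖ ^ 2) volume)
    (hZ : Integrable (fun x => ‖curl V x‖ ^ 2) volume)
    (hZ2 : Integrable (fun x => ‖fderiv ℝ (curl V) x (EuclideanSpace.single (2 : Fin 3) (1 : ℝ))‖ ^ 2) volume)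
    (hP2 : Integrable (fun x => ‖fderiv ℝ (fun y => fderiv ℝ V y (EuclideanSpace.single (2 : Fin 3) (1 : ℝ))) x
      (EuclideanSpace.single (2 : Fin 3) (1 : ℝ))‖ ^ 2) volume)
    (hslab : Integrable (fun x => {x : EuclideanSpace ℝ (Fin 3) | |x 2| ≤ T}.indicator (fun x => ‖V x‖ ^ 2) x) volume) :
    (∫ x, ⟪curl V x, curl (fun y : EuclideanSpace ℝ (Fin 3) =>
        g (y 2) • fderiv ℝ V y (EuclideanSpace.single (2 : Fin 3) (1 : ℝ)) +
          deriv g (y 2) • (V y - (V y 2) • EuclideanSpace.single (2 : Fin 3) (1 : ℝ))) x⟫) =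
      (∫ x, deriv g (x 2) *
          ((3 / 2) * (fderiv ℝ V x (EuclideanSpace.single 2 1) 0 ^ 2 + fderiv ℝ V x (EuclideanSpace.single 2 1) 1 ^ 2) +
            (1 / 2) * curl V x 2 ^ 2 -
            (1 / 2) * (fderiv ℝ V x (EuclideanSpace.single 0 1) 2 ^ 2 + fderiv ℝ V x (EuclideanSpace.single 1 1) 2 ^ 2) -
            (fderiv ℝ V x (EuclideanSpace.single 0 1) 2 * fderiv ℝ V x (EuclideanSpace.single 2 1) 0 +
              fderiv ℝ V x (EuclideanSpace.single 1 1) 2 * fderiv ℝ V x (EuclideanSpace.single 2 1) 1))) +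
        2 * (∫ x, deriv g (x 2) * (fderiv ℝ V x (EuclideanSpace.single (2 : Fin 3) (1 : ℝ)) 2) ^ 2) +
        2 * ∫ x, deriv g (x 2) *
          (fderiv ℝ V x (EuclideanSpace.single 0 1) 2 * fderiv ℝ V x (EuclideanSpace.single 2 1) 0 +
            fderiv ℝ V x (EuclideanSpace.single 1 1) 2 * fderiv ℝ V x (EuclideanSpace.single 2 1) 1) := by
  set e₂ : EuclideanSpace ℝ (Fin 3) := EuclideanSpace.single (2 : Fin 3) (1 : ℝ) with he₂
  have hK0 : 0 ≤ K := (abs_nonneg _).trans (hgK 0)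
  have hV1 : ContDiff ℝ 1 V := hV.of_le (by norm_num)
  have hVd : Differentiable ℝ V := hV.differentiable two_ne_zero
  have cV : Continuous V := hV.continuous
  have cDV : Continuous (fderiv ℝ V) := hV.continuous_fderiv two_ne_zero
  have hgd2 : ContDiff ℝ 2 (deriv g) := by
    have h3 : ContDiff ℝ (2 + 1) g := by rw [show ((2 : WithTop ℕ∞) + 1) = 3 by norm_num]; exact hg
    exact h3.deriv'
  have hgd1 : ContDiff ℝ 1 (deriv (deriv g)) := by
    have h2 : ContDiff ℝ (1 + 1) (deriv g) := by rw [show ((1 : WithTop ℕ∞) + 1) = 2 by norm_num]; exact hgd2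
    exact h2.deriv'
  have cg1 : Continuous (deriv g) := hgd2.continuous
  have cg2 : Continuous (deriv (deriv g)) := hgd1.continuous
  have cg3 : Continuous (deriv (deriv (deriv g))) := hgd1.continuous_deriv le_rfl
  -- (1) the law with the boundary energy
  rw [slideEnstrophyLaw hV hdiv hg hgK hg1K hg2K hg3K hg2T hg3T hD hZ hZ2 hslab]
  -- (2) flux invariance kills `∫g‴‖V‖²`
  have hflux : (∫ x, deriv (deriv (deriv g)) (x 2) * ‖V x‖ ^ 2) = 0 :=
    integral_deriv_axialTest_mul_sq_eq_zero hV1 hdiv hVc hc0 hc1 hc2 hgd1 hT hg2T hslab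
  have i3V : Integrable (fun x => deriv (deriv (deriv g)) (x 2) * ‖V x‖ ^ 2) volume := by
    set SL : Set (EuclideanSpace ℝ (Fin 3)) := {x | |x 2| ≤ T} with hSL
    refine (hslab.const_mul K).mono' ((cg3.comp (PiLp.continuous_apply 2 _ (2 : Fin 3))).mul
      (cV.norm.pow 2)).aestronglyMeasurable (Eventually.of_forall fun x => ?_)
    rw [Real.norm_eq_abs, abs_mul, abs_of_nonneg (sq_nonneg ‖V x‖)]
    by_cases hx : deriv (deriv (deriv g)) (x 2) = 0
    · rw [hx, abs_zero, zero_mul]; exact mul_nonneg hK0 (indicator_nonneg (fun _ _ => sq_nonneg _) _)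
    have hxT : |x 2| ≤ T := by by_contra hc; exact hx (hg3T _ (not_le.1 hc).le)
    rw [indicator_of_mem (show x ∈ SL from hxT)]
    exact mul_le_mul_of_nonneg_right (hg3K _) (sq_nonneg _)
  have i3V2 : Integrable (fun x => deriv (deriv (deriv g)) (x 2) * (V x 2) ^ 2) volume :=
    integrable_axialWeight_mul_coord_sq hV1 cg3 hg3K hg3T hslab
  have hbare : (∫ x, deriv (deriv (deriv g)) (x 2) * (‖V x‖ ^ 2 - 2 * (V x 2) ^ 2)) =
      -2 * ∫ x, deriv (deriv (deriv g)) (x 2) * (V x 2) ^ 2 := by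
    have e : (fun x => deriv (deriv (deriv g)) (x 2) * (‖V x‖ ^ 2 - 2 * (V x 2) ^ 2)) =
        fun x => deriv (deriv (deriv g)) (x 2) * ‖V x‖ ^ 2 - 2 * (deriv (deriv (deriv g)) (x 2) * (V x 2) ^ 2) := by
      funext x; ring
    rw [e, integral_sub i3V (i3V2.const_mul 2), integral_const_mul, hflux]
    ring
  -- (3) kinematics of `∫g‴V₂²`
  have j0 : Integrable (fun x => deriv (deriv g) (x 2) * (V x 2) ^ 2) volume :=
    integrable_axialWeight_mul_coord_sq hV1 cg2 hg2K hg2T hslab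
  have j2 : Integrable (fun x => deriv (deriv g) (x 2) * (V x 2 * fderiv ℝ V x e₂ 2)) volume :=
    integrable_axialWeight_mul_coord_mul_fderiv hV1 cg2 hg2K hg2T hD hslab 2 2 2
  have k0 : Integrable (fun x => deriv g (x 2) * (V x 2 * fderiv ℝ V x e₂ 2)) volume :=
    integrable_axialWeight_mul_coord_mul_fderiv hV1 cg1 hg1K hg1T hD hslab 2 2 2
  have cc : ∀ i j : Fin 3, Continuous fun x => fderiv ℝ V x (EuclideanSpace.single j 1) i := fun i j =>
    (PiLp.continuous_apply 2 _ i).comp (cDV.clm_apply continuous_const)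
  have cg1x : Continuous fun x : EuclideanSpace ℝ (Fin 3) => deriv g (x 2) := cg1.comp (PiLp.continuous_apply 2 _ (2 : Fin 3))
  have k2a : Integrable (fun x => deriv g (x 2) * (fderiv ℝ V x e₂ 2) ^ 2) volume := by
    refine (hD.const_mul K).mono' (cg1x.mul ((cc 2 2).pow 2)).aestronglyMeasurable (Eventually.of_forall fun x => ?_)
    rw [Real.norm_eq_abs, abs_mul, abs_of_nonneg (sq_nonneg (fderiv ℝ V x e₂ 2))]
    have h := abs_fderiv_coord_le_norm V x 2 2
    have h2 : (fderiv ℝ V x e₂ 2) ^ 2 ≤ ‖fderiv ℝ V x‖ ^ 2 := by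
      rw [← sq_abs]; exact pow_le_pow_left₀ (abs_nonneg _) h 2
    exact mul_le_mul (hg1K _) h2 (sq_nonneg _) hK0
  -- the second-derivative field `P = ∂₂V`
  set P : EuclideanSpace ℝ (Fin 3) → EuclideanSpace ℝ (Fin 3) := fun y => fderiv ℝ V y e₂ with hP
  have hP1 : ContDiff ℝ 1 P := contDiff_fderiv_apply_const_succ (n := 1) (by exact_mod_cast hV) e₂
  have cP : Continuous P := hP1.continuous
  have cDP : Continuous (fderiv ℝ P) := hP1.continuous_fderiv one_ne_zero
  set SL : Set (EuclideanSpace ℝ (Fin 3)) := {x | |x 2| ≤ T} with hSL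
  have k2b : Integrable (fun x => deriv g (x 2) * V x 2 * fderiv ℝ P x e₂ 2) volume := by
    have iG2 : Integrable (fun x => K * (SL.indicator (fun x => ‖V x‖ ^ 2) x + ‖fderiv ℝ P x e₂‖ ^ 2)) volume :=
      (hslab.add hP2).const_mul K
    refine iG2.mono' ((cg1x.mul ((PiLp.continuous_apply 2 _ (2 : Fin 3)).comp cV)).mul
      ((PiLp.continuous_apply 2 _ (2 : Fin 3)).comp (cDP.clm_apply continuous_const))).aestronglyMeasurable
      (Eventually.of_forall fun x => ?_)
    dsimp only
    rw [Real.norm_eq_abs, abs_mul, abs_mul]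
    by_cases hx : deriv g (x 2) = 0
    · rw [hx, abs_zero, zero_mul, zero_mul]
      exact mul_nonneg hK0 (add_nonneg (indicator_nonneg (fun _ _ => sq_nonneg _) _) (sq_nonneg _))
    have hxT : |x 2| ≤ T := by by_contra hc'; exact hx (hg1T _ (not_le.1 hc').le)
    rw [indicator_of_mem (show x ∈ SL from hxT)]
    have h1 : |V x 2| * |fderiv ℝ P x e₂ 2| ≤ ‖V x‖ * ‖fderiv ℝ P x e₂‖ :=
      mul_le_mul (abs_coord_le_norm _ 2) (abs_coord_le_norm _ 2) (abs_nonneg _) (norm_nonneg _)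
    have h2 : ‖V x‖ * ‖fderiv ℝ P x e₂‖ ≤ ‖V x‖ ^ 2 + ‖fderiv ℝ P x e₂‖ ^ 2 := by
      nlinarith [sq_nonneg (‖V x‖ - ‖fderiv ℝ P x e₂‖), norm_nonneg (V x), norm_nonneg (fderiv ℝ P x e₂)]
    calc |deriv g (x 2)| * |V x 2| * |fderiv ℝ P x e₂ 2| = |deriv g (x 2)| * (|V x 2| * |fderiv ℝ P x e₂ 2|) := by ring
      _ ≤ K * (‖V x‖ * ‖fderiv ℝ P x e₂‖) := mul_le_mul (hg1K _) h1 (by positivity) hK0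
      _ ≤ K * (‖V x‖ ^ 2 + ‖fderiv ℝ P x e₂‖ ^ 2) := mul_le_mul_of_nonneg_left h2 hK0
  have l0 : Integrable (fun x => (deriv g (x 2) * V x 2) • (fderiv ℝ V x e₂ - (fderiv ℝ V x e₂ 2) • e₂)) volume := by
    have iG3 : Integrable (fun x => 2 * K * (SL.indicator (fun x => ‖V x‖ ^ 2) x + ‖fderiv ℝ V x‖ ^ 2)) volume :=
      (hslab.add hD).const_mul (2 * K)
    refine iG3.mono' ((cg1x.mul ((PiLp.continuous_apply 2 _ (2 : Fin 3)).comp cV)).smul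
      ((cDV.clm_apply continuous_const).sub (((PiLp.continuous_apply 2 _ (2 : Fin 3)).comp
        (cDV.clm_apply continuous_const)).smul continuous_const))).aestronglyMeasurable
      (Eventually.of_forall fun x => ?_)
    dsimp only
    by_cases hx : deriv g (x 2) = 0
    · rw [hx, zero_mul, zero_smul, norm_zero]
      exact mul_nonneg (by positivity) (add_nonneg (indicator_nonneg (fun _ _ => sq_nonneg _) _) (sq_nonneg _))
    have hxT : |x 2| ≤ T := by by_contra hc'; exact hx (hg1T _ (not_le.1 hc').le)
    rw [indicator_of_mem (show x ∈ SL from hxT), norm_smul, Real.norm_eq_abs, abs_mul]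
    have hne : ‖e₂‖ = 1 := by rw [he₂, PiLp.norm_single, norm_one]
    have hA : ‖fderiv ℝ V x e₂ - (fderiv ℝ V x e₂ 2) • e₂‖ ≤ 2 * ‖fderiv ℝ V x‖ := by
      have h1 : ‖fderiv ℝ V x e₂‖ ≤ ‖fderiv ℝ V x‖ := by
        calc ‖fderiv ℝ V x e₂‖ ≤ ‖fderiv ℝ V x‖ * ‖e₂‖ := (fderiv ℝ V x).le_opNorm _
          _ = ‖fderiv ℝ V x‖ := by rw [hne, mul_one]
      have h2 : ‖(fderiv ℝ V x e₂ 2) • e₂‖ ≤ ‖fderiv ℝ V x‖ := by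
        rw [norm_smul, hne, mul_one, Real.norm_eq_abs, he₂]; exact abs_fderiv_coord_le_norm V x 2 2
      calc ‖fderiv ℝ V x e₂ - (fderiv ℝ V x e₂ 2) • e₂‖ ≤ ‖fderiv ℝ V x e₂‖ + ‖(fderiv ℝ V x e₂ 2) • e₂‖ := norm_sub_le _ _
        _ ≤ 2 * ‖fderiv ℝ V x‖ := by linarith
    have h3 : |deriv g (x 2)| * |V x 2| ≤ K * ‖V x‖ := mul_le_mul (hg1K _) (abs_coord_le_norm _ 2) (abs_nonneg _) hK0
    have h4 : ‖V x‖ * ‖fderiv ℝ V x‖ ≤ ‖V x‖ ^ 2 + ‖fderiv ℝ V x‖ ^ 2 := by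
      nlinarith [sq_nonneg (‖V x‖ - ‖fderiv ℝ V x‖), norm_nonneg (V x), norm_nonneg (fderiv ℝ V x)]
    calc |deriv g (x 2)| * |V x 2| * ‖fderiv ℝ V x e₂ - (fderiv ℝ V x e₂ 2) • e₂‖ ≤ (K * ‖V x‖) * (2 * ‖fderiv ℝ V x‖) :=
          mul_le_mul h3 hA (norm_nonneg _) (mul_nonneg hK0 (norm_nonneg _))
      _ = 2 * K * (‖V x‖ * ‖fderiv ℝ V x‖) := by ring
      _ ≤ 2 * K * (‖V x‖ ^ 2 + ‖fderiv ℝ V x‖ ^ 2) := mul_le_mul_of_nonneg_left h4 (by positivity)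
  have l1 : Integrable (fun x => deriv g (x 2) *
      (fderiv ℝ V x (EuclideanSpace.single 0 1) 2 * fderiv ℝ V x (EuclideanSpace.single 2 1) 0 +
        fderiv ℝ V x (EuclideanSpace.single 1 1) 2 * fderiv ℝ V x (EuclideanSpace.single 2 1) 1)) volume := by
    refine ((hD.const_mul (2 * K))).mono' (cg1x.mul (((cc 2 0).mul (cc 0 2)).add ((cc 2 1).mul (cc 1 2)))).aestronglyMeasurable
      (Eventually.of_forall fun x => ?_)
    rw [Real.norm_eq_abs, abs_mul]
    have a1 := abs_fderiv_coord_le_norm V x 2 0; have a2 := abs_fderiv_coord_le_norm V x 0 2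
    have a3 := abs_fderiv_coord_le_norm V x 2 1; have a4 := abs_fderiv_coord_le_norm V x 1 2
    rw [abs_le] at a1 a2 a3 a4
    have hq : |fderiv ℝ V x (EuclideanSpace.single 0 1) 2 * fderiv ℝ V x (EuclideanSpace.single 2 1) 0 +
        fderiv ℝ V x (EuclideanSpace.single 1 1) 2 * fderiv ℝ V x (EuclideanSpace.single 2 1) 1| ≤ 2 * ‖fderiv ℝ V x‖ ^ 2 := by
      rw [abs_le]; constructor <;> nlinarith [sq_nonneg (fderiv ℝ V x (EuclideanSpace.single 0 1) 2 + fderiv ℝ V x (EuclideanSpace.single 2 1) 0),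
        sq_nonneg (fderiv ℝ V x (EuclideanSpace.single 1 1) 2 + fderiv ℝ V x (EuclideanSpace.single 2 1) 1),
        sq_nonneg (fderiv ℝ V x (EuclideanSpace.single 0 1) 2 - fderiv ℝ V x (EuclideanSpace.single 2 1) 0),
        sq_nonneg (fderiv ℝ V x (EuclideanSpace.single 1 1) 2 - fderiv ℝ V x (EuclideanSpace.single 2 1) 1), norm_nonneg (fderiv ℝ V x)]
    calc |deriv g (x 2)| * _ ≤ K * (2 * ‖fderiv ℝ V x‖ ^ 2) := mul_le_mul (hg1K _) hq (abs_nonneg _) hK0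
      _ = 2 * K * ‖fderiv ℝ V x‖ ^ 2 := by ring
  have hkin := integral_thirdDeriv_weight_mul_sq_eq hV hdiv hg j0 i3V2 j2 k0 k2a k2b l0 l1
  rw [hbare, hkin]
  ring

end ExtremiserLiouville

end Summit.NavierStokesRegularity.NavierStokesRegularity.Theorems

end
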